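import Mathlib
import HarnessLib
import HarnessLib.Audit
import Summits.MatrixMultiplication.MatrixMultiplication.Theses.NilpotentLieHosts
import Summits.MatrixMultiplication.MatrixMultiplication.Theorems.NilpotentLieHostsUnitriangularCostShape
import Summits.MatrixMultiplication.MatrixMultiplication.Theorems.NilpotentLieHostsUnitriangularCostShapeStubProductModel
import Summits.MatrixMultiplication.MatrixMultiplication.Theorems.NilpotentLieHostsUnitriangularCostShapeStubModelHosts
import Summits.MatrixMultiplication.MatrixMultiplication.Theorems.NilpotentLieHostsUnitriangularCostShapeStubTruncatedMatrixCost

/-!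
# `NilpotentThresholdDesigns` (stmt-MatrixMultiplication-7720) is SUMMIT-STRENGTH — and strictly more than the route needs

Route `NilpotentLieHosts`, crux #0 `NilpotentThresholdDesigns` ("some `U_d(ℤ)`, `d ≥ 3`, carries, for every `δ > 0` and
unboundedly many weighted-degree budgets `s`, TPP designs with degree-`≤ s` separating polynomials and
`|X||Y||Z| ≥ s^((3/4)d(d−1) − δ)`").  Three facts, all quantifier bookkeeping over LANDED theorems, recorded by the
redirect strategist (unit `cstrat-stmt-MatrixMultiplication-7720-r1`) for its `STRATEGY-CENSUS.md` and for the tribunal.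
(Crux workfile `Cruxes/NilpotentThresholdDesigns/SummitStrength.lean`: `Theorems/` is prover-only, D-0016; the file is
self-contained over tree imports and 0-sorry, so the crux lead may land it verbatim under
`Theorems/NilpotentLieHostsNilpotentThresholdDesignsSummitStrength.lean --supports stmt-MatrixMultiplication-7720`.)

1. **Clause (T) is redundant.**  The separating-polynomial clause (S) already forces the triple-product clause (T):
   evaluate the `(x', z')`-indicator at the two quadruples `(x, y, y', z)` and `(x', y, y, z')`, which have the same
   quotient `x y⁻¹ y' z⁻¹ = x' z'⁻¹` (`tpp_of_separating`, an abstract group lemma; `nilpotentThresholdDesigns_iff_sepOnly`).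
   So the crux is a statement about ONE object only: point sets of `U_d(ℤ)³` whose quotient map admits low-degree
   indicator interpolants — there is no separate "TPP piece" to split off.
2. **`C → S` is a theorem of the tree.**  With the cost crux `UnitriangularCostShape` (stmt-7724) CLOSED by
   `unitriangularCostShape_proof`, the route's deciding theorem `closes` gives
   `NilpotentThresholdDesigns → MatrixMultiplication` outright (`nilpotentThresholdDesigns_implies_matrixMultiplication`).
   The converse `MatrixMultiplication → NilpotentThresholdDesigns` is NOT in the tree (probe `exact? | aesop` fails):
   `ω = 2` says nothing about designs inside a fixed `U_d(ℤ)`.  Hence every line for the crux is a line for `ω = 2`.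
3. **The crux is STRICTLY stronger than what `closes` consumes.**  The AMORTISED form `TowerDesigns`
   ("for every `ε > 0` SOME `d ≥ 3` with deficit `ε·⌊d/2⌋`", the exact analogue of the `q^(n²/2 − o(n))`-type losses of
   the finite-group constructions) is a one-line consequence of the crux (`towerDesigns_of_nilpotentThresholdDesigns`) and
   still yields `ω = 2` against the explicit cost exponent `((D − ⌊d/2⌋)/2)·ω + ⌊d/2⌋`, `D = d(d−1)/2`, obtained by
   re-composing the three landed stubs of `UnitriangularCostShape` with the Casimir count `b = ⌊d/2⌋` made explicit
   (`unitriangularCostShapeExplicit_proof`, `matrixMultiplication_of_towerDesigns`).  Section 3 is the typed finding of the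
   first strategist (unit `cstrat-…-7720-s2`, `Cruxes/NilpotentThresholdDesigns/StrategistSketch.lean`), landed here verbatim
   so that it is importable; the tenure planner can re-target the route to `TowerDesigns` with `matrixMultiplication_of_towerDesigns` as glue.

References: J. Blasiak, H. Cohn, J. A. Grochow, K. Pratt, C. Umans, *Finite matrix multiplication algorithms from infinite
groups*, arXiv:2410.14905 (2024), Def 2.1, Thm B; H. Cohn, C. Umans, *A group-theoretic approach to fast matrix
multiplication*, FOCS 2003 (TPP, Lem 2.4 / Thm 4.1 packing).
-/

set_option linter.dupNamespace false
set_option linter.unusedVariables false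

noncomputable section

namespace Summit.MatrixMultiplication.MatrixMultiplication.Cruxes.NilpotentThresholdDesigns.SummitStrength

open Summit.MatrixMultiplication.MatrixMultiplication.Theses.NilpotentLieHosts
open Summit.MatrixMultiplication.MatrixMultiplication.Theorems
open scoped BigOperators Matrix

/-! ## 1. The separation clause (S) already contains the TPP clause (T) -/

/-- **Abstract redundancy of TPP under separation.**  In any group, if for every `(x₀, z₀) ∈ X × Z` some function `f`
of the quotient `x y⁻¹ y' z⁻¹` takes the value `1` on `X × Y × Y × Z` exactly on `{x = x₀ ∧ y = y' ∧ z = z₀}` (e.g. an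
indicator interpolant), then the triple-product property holds: from `x y⁻¹ y' z⁻¹ = x' z'⁻¹ = x' y⁻¹ y z'⁻¹` the
`(x', z')`-function takes the same value at `(x, y, y', z)` and at `(x', y, y, z')`, where it is `1`.  No decidability,
no field structure: only `f ⁻¹' {1}` matters. -/
theorem tpp_of_separating {G : Type*} [Group G] {R : Type*} [One R] (X Y Z : Finset G)
    (hS : ∀ x₀ ∈ X, ∀ z₀ ∈ Z, ∃ f : G → R, ∀ x ∈ X, ∀ y ∈ Y, ∀ y' ∈ Y, ∀ z ∈ Z,
      (x = x₀ ∧ y = y' ∧ z = z₀ ↔ f (x * y⁻¹ * y' * z⁻¹) = 1)) :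
    ∀ x ∈ X, ∀ x' ∈ X, ∀ y ∈ Y, ∀ y' ∈ Y, ∀ z ∈ Z, ∀ z' ∈ Z,
      x * y⁻¹ * y' * z⁻¹ = x' * z'⁻¹ → x = x' ∧ y = y' ∧ z = z' := by
  intro x hx x' hx' y hy y' hy' z hz z' hz' hq
  obtain ⟨f, hf⟩ := hS x' hx' z' hz'
  have h2 : f (x' * y⁻¹ * y * z'⁻¹) = 1 := (hf x' hx' y hy y hy z' hz').1 ⟨rfl, rfl, rfl⟩
  have hq' : x' * y⁻¹ * y * z'⁻¹ = x * y⁻¹ * y' * z⁻¹ := by rw [hq]; group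
  rw [hq'] at h2
  exact (hf x hx y hy y' hy' z hz).2 h2

/-- **The crux with clause (T) deleted** is equivalent to the crux: (S) ⇒ (T) by `tpp_of_separating` applied to
`f := fun g => MvPolynomial.eval (entries of g) p` (off the indicator's support the value is `0 ≠ 1`). -/
theorem nilpotentThresholdDesigns_iff_sepOnly :
    NilpotentThresholdDesigns ↔
    ∃ d : ℕ, 3 ≤ d ∧ ∀ δ : ℝ, 0 < δ → ∀ s₀ : ℕ, ∃ s : ℕ, s₀ ≤ s ∧
      ∃ X Y Z : Finset (Matrix.SpecialLinearGroup (Fin d) ℤ),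
        (∀ g ∈ X ∪ Y ∪ Z, ∀ i j : Fin d, j ≤ i → (g : Matrix (Fin d) (Fin d) ℤ) i j = if i = j then 1 else 0) ∧
        (∀ x₀ ∈ X, ∀ z₀ ∈ Z, ∃ p : MvPolynomial (Fin d × Fin d) ℂ,
          MvPolynomial.weightedTotalDegree (fun ij : Fin d × Fin d => (ij.2 : ℕ) - ij.1) p ≤ s ∧
          ∀ x ∈ X, ∀ y ∈ Y, ∀ y' ∈ Y, ∀ z ∈ Z,
            MvPolynomial.eval (fun ij : Fin d × Fin d =>
              (((x * y⁻¹ * y' * z⁻¹ : Matrix.SpecialLinearGroup (Fin d) ℤ) : Matrix (Fin d) (Fin d) ℤ) ij.1 ij.2 : ℂ)) p =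
            if x = x₀ ∧ y = y' ∧ z = z₀ then 1 else 0) ∧
        (s : ℝ) ^ ((3 : ℝ) / 4 * d * (d - 1) - δ) ≤ (X.card : ℝ) * Y.card * Z.card := by
  constructor
  · rintro ⟨d, hd3, hD⟩
    refine ⟨d, hd3, fun δ hδ s₀ => ?_⟩
    obtain ⟨s, hs, X, Y, Z, hU, -, hS, hV⟩ := hD δ hδ s₀
    exact ⟨s, hs, X, Y, Z, hU, hS, hV⟩
  · rintro ⟨d, hd3, hD⟩
    refine ⟨d, hd3, fun δ hδ s₀ => ?_⟩
    obtain ⟨s, hs, X, Y, Z, hU, hS, hV⟩ := hD δ hδ s₀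
    refine ⟨s, hs, X, Y, Z, hU, ?_, hS, hV⟩
    refine tpp_of_separating (R := ℂ) X Y Z fun x₀ hx₀ z₀ hz₀ => ?_
    obtain ⟨p, -, hp⟩ := hS x₀ hx₀ z₀ hz₀
    refine ⟨fun g => MvPolynomial.eval (fun ij : Fin d × Fin d =>
      (((g : Matrix.SpecialLinearGroup (Fin d) ℤ) : Matrix (Fin d) (Fin d) ℤ) ij.1 ij.2 : ℂ)) p,
      fun x hx y hy y' hy' z hz => ?_⟩
    have h := hp x hx y hy y' hy' z hz
    dsimp only
    rw [h]
    refine ⟨fun hc => if_pos hc, fun h1 => ?_⟩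
    by_contra hc
    rw [if_neg hc] at h1
    exact zero_ne_one h1

/-! ## 2. `C → S`: the crux implies the summit outright -/

/-- **Summit strength of the crux.**  `NilpotentThresholdDesigns → ω(ℂ) = 2`, by the route's deciding theorem `closes`
fed with the LANDED cost crux `unitriangularCostShape_proof` (stmt-7724).  This is the `C → S` probe of the redirect
strategist closing in one term; the converse probe (`MatrixMultiplication → NilpotentThresholdDesigns` by
`exact? | aesop`) fails — no theorem of the tree produces fixed-dimension designs from `ω = 2`. -/
theorem nilpotentThresholdDesigns_implies_matrixMultiplication :
    NilpotentThresholdDesigns → MatrixMultiplication :=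
  fun h => closes unitriangularCostShape_proof h

/-! ## 3. The amortised tower: a strictly weaker design statement that still closes the route

Typed and proved by the first strategist (unit `cstrat-stmt-MatrixMultiplication-7720-s2`,
`Cruxes/NilpotentThresholdDesigns/StrategistSketch.lean`); reproduced verbatim to make it importable. -/

/-- Cost crux with the explicit Casimir count `b = ⌊d/2⌋` (the landed proof of `UnitriangularCostShape`
hides it behind `∃ b > 0`). -/
def UnitriangularCostShapeExplicit : Prop :=
  ∀ d : ℕ, 3 ≤ d → ∃ C : ℝ, ∀ (s : ℕ) (X Y Z : Finset (Matrix.SpecialLinearGroup (Fin d) ℤ)), (∀ g ∈ X ∪ Y ∪ Z, ∀ i j : Fin d, j ≤ i → (g : Matrix (Fin d) (Fin d) ℤ) i j = if i = j then 1 else 0) → (∀ x ∈ X, ∀ x' ∈ X, ∀ y ∈ Y, ∀ y' ∈ Y, ∀ z ∈ Z, ∀ z' ∈ Z, x * y⁻¹ * y' * z⁻¹ = x' * z'⁻¹ → x = x' ∧ y = y' ∧ z = z') → (∀ x₀ ∈ X, ∀ z₀ ∈ Z, ∃ p : MvPolynomial (Fin d × Fin d) ℂ, MvPolynomial.weightedTotalDegree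 (fun ij : Fin d × Fin d => (ij.2 : ℕ) - ij.1) p ≤ s ∧ ∀ x ∈ X, ∀ y ∈ Y, ∀ y' ∈ Y, ∀ z ∈ Z, MvPolynomial.eval (fun ij : Fin d × Fin d => (((x * y⁻¹ * y' * z⁻¹ : Matrix.SpecialLinearGroup (Fin d) ℤ) : Matrix (Fin d) (Fin d) ℤ) ij.1 ij.2 : ℂ)) p = if x = x₀ ∧ y = y' ∧ z = z₀ then 1 else 0) → ((X.card : ℝ) * Y.card * Z.card) ^ (Literature.Computability.AlgebraicComplexity.omega ℂ / 3) ≤ C * ((s : ℝ) + 1) ^ (((d : ℝ) * (d - 1) / 2 - ((d / 2 : ℕ) : ℝ)) / 2 * Literature.Computability.AlgebraicComplexity.omega ℂ + ((d / 2 : ℕ) : ℝ))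

/-- AMORTISED TOWER DESIGNS (an OPEN conjecture of this route, never asserted — used only as a hypothesis
`(h : TowerDesigns)`; it implies `ω = 2` by `matrixMultiplication_of_towerDesigns`): for every `ε > 0` some `U_d(ℤ)`,
`d ≥ 3`, carries, for unboundedly many budgets `s`, TPP designs with weighted-degree-`≤ s` separating polynomials and
`|X||Y||Z| ≥ s^((3/4)d(d−1) − ε·⌊d/2⌋)` — deficit `ε·⌊d/2⌋` instead of the crux's `δ → 0` at fixed `d`.
A consequence of the crux (`towerDesigns_of_nilpotentThresholdDesigns`). -/
@[conjecture] def TowerDesigns : Prop :=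
  ∀ ε : ℝ, 0 < ε → ∃ d : ℕ, 3 ≤ d ∧ ∀ s₀ : ℕ, ∃ s : ℕ, s₀ ≤ s ∧ ∃ X Y Z : Finset (Matrix.SpecialLinearGroup (Fin d) ℤ), (∀ g ∈ X ∪ Y ∪ Z, ∀ i j : Fin d, j ≤ i → (g : Matrix (Fin d) (Fin d) ℤ) i j = if i = j then 1 else 0) ∧ (∀ x ∈ X, ∀ x' ∈ X, ∀ y ∈ Y, ∀ y' ∈ Y, ∀ z ∈ Z, ∀ z' ∈ Z, x * y⁻¹ * y' * z⁻¹ = x' * z'⁻¹ → x = x' ∧ y = y' ∧ z = z') ∧ (∀ x₀ ∈ X, ∀ z₀ ∈ Z, ∃ p : MvPolynomial (Fin d × Fin d) ℂ, MvPolynomial.weightedTotalDegree (fun ij : Fin d × Fin d => (ij.2 : ℕ) - ij.1) p ≤ s ∧ ∀ x ∈ X, ∀ y ∈ Y, ∀ y' ∈ Y, ∀ z ∈ Z, MvPolynomial.eval (fun ij : Fin d × Fin d => (((x * y⁻¹ * y' * z⁻¹ : Matrix.SpecialLinearGroup (Fin d) ℤ) : Matrix (Fin d) (Fin d) ℤ)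 ij.1 ij.2 : ℂ)) p = if x = x₀ ∧ y = y' ∧ z = z₀ then 1 else 0) ∧ (s : ℝ) ^ ((3 : ℝ) / 4 * d * (d - 1) - ε * ((d / 2 : ℕ) : ℝ)) ≤ (X.card : ℝ) * Y.card * Z.card

/-- **The explicit cost shape is provable now**: the composition of the three LANDED stubs of
`UnitriangularCostShape` (product model with `k = ⌊d/2⌋` Casimirs, hosting, truncated matrix cost). -/
theorem unitriangularCostShapeExplicit_proof : UnitriangularCostShapeExplicit := by
  intro d hd
  obtain ⟨c, hc, hmodel⟩ := UnitriangularCostShape.productModel_explicit d hd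
  obtain ⟨κ, hκ, hcostk⟩ := UnitriangularCostShape.stub_truncatedMatrixCost (d / 2)
  refine ⟨κ * c ^ Literature.Computability.AlgebraicComplexity.omega ℂ * c, ?_⟩
  intro s X Y Z hU _hT hS
  obtain ⟨t, N, hN, ht, ρ, hρ⟩ := hmodel s
  obtain ⟨α, β, γ, hhost⟩ := UnitriangularCostShape.stub_modelHosts d (d / 2) t N s ρ X Y Z hρ hU hS
  have hcost := hcostk t N X.card Y.card Z.card α β γ hhost
  set w : ℝ := Literature.Computability.AlgebraicComplexity.omega ℂ with hw
  set b : ℝ := ((d / 2 : ℕ) : ℝ) with hb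
  set A : ℝ := ((d : ℝ) * (d - 1) / 2 - b) / 2 with hA
  have hw0 : 0 ≤ w :=
    zero_le_two.trans (Literature.Computability.AlgebraicComplexity.omega_two_le ℂ)
  have hs0 : (0 : ℝ) < (s : ℝ) + 1 := by positivity
  have hsA : (0 : ℝ) ≤ ((s : ℝ) + 1) ^ A := Real.rpow_nonneg hs0.le A
  have hcw : (0 : ℝ) ≤ c ^ w := Real.rpow_nonneg hc.le w
  have h1 : (N : ℝ) ^ w ≤ c ^ w * ((s : ℝ) + 1) ^ (A * w) :=
    calc (N : ℝ) ^ w ≤ (c * ((s : ℝ) + 1) ^ A) ^ w := Real.rpow_le_rpow (Nat.cast_nonneg N) hN hw0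
      _ = c ^ w * (((s : ℝ) + 1) ^ A) ^ w := Real.mul_rpow hc.le hsA
      _ = c ^ w * ((s : ℝ) + 1) ^ (A * w) := by rw [Real.rpow_mul hs0.le]
  have h2 : (N : ℝ) ^ w * (t : ℝ) ^ (d / 2) ≤
      (c ^ w * ((s : ℝ) + 1) ^ (A * w)) * (c * ((s : ℝ) + 1) ^ b) :=
    mul_le_mul h1 ht (by positivity) (mul_nonneg hcw (Real.rpow_nonneg hs0.le _))
  have h3 : κ * ((c ^ w * ((s : ℝ) + 1) ^ (A * w)) * (c * ((s : ℝ) + 1) ^ b)) =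
      κ * c ^ w * c * ((s : ℝ) + 1) ^ (A * w + b) := by
    rw [Real.rpow_add hs0]
    ring
  have hcard : ((X.card * Y.card * Z.card : ℕ) : ℝ) = (X.card : ℝ) * Y.card * Z.card := by
    simp only [Nat.cast_mul]
  calc ((X.card : ℝ) * Y.card * Z.card) ^ (w / 3)
      = ((X.card * Y.card * Z.card : ℕ) : ℝ) ^ (w / 3) := by rw [hcard]
    _ ≤ κ * (N : ℝ) ^ w * (t : ℝ) ^ (d / 2) := hcost
    _ = κ * ((N : ℝ) ^ w * (t : ℝ) ^ (d / 2)) := by ring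
    _ ≤ κ * ((c ^ w * ((s : ℝ) + 1) ^ (A * w)) * (c * ((s : ℝ) + 1) ^ b)) :=
      mul_le_mul_of_nonneg_left h2 hκ.le
    _ = κ * c ^ w * c * ((s : ℝ) + 1) ^ (A * w + b) := h3

/-- The amortised tower statement is a CONSEQUENCE of the crux (take the crux's `d` and `δ := ε·⌊d/2⌋`). -/
theorem towerDesigns_of_nilpotentThresholdDesigns : NilpotentThresholdDesigns → TowerDesigns := by
  rintro ⟨d, hd3, hD⟩ ε hε
  refine ⟨d, hd3, fun s₀ => ?_⟩
  have hb : (0 : ℝ) < ((d / 2 : ℕ) : ℝ) := by exact_mod_cast (show 0 < d / 2 by omega)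
  obtain ⟨s, hs, X, Y, Z, hU, hT, hS, hV⟩ := hD (ε * ((d / 2 : ℕ) : ℝ)) (mul_pos hε hb) s₀
  exact ⟨s, hs, X, Y, Z, hU, hT, hS, hV⟩

/-- **The amortised tower still decides the summit, unconditionally in the tree today**: `TowerDesigns → ω(ℂ) = 2`
(the explicit cost shape being PROVED, `unitriangularCostShapeExplicit_proof`): if `2 < ω`, feed the tower the loss `ε := 3(ω−2)/(4ω)`; at the returned `d` (with
`b = ⌊d/2⌋ ≥ 1`) the design exponent times `ω/3` exceeds the cost exponent
`F = ((D − b)/2)ω + b` by `g = b(ω−2)/4 > 0`, contradicting unbounded budgets. -/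
theorem matrixMultiplication_of_towerDesigns (hTower : TowerDesigns) : MatrixMultiplication := by
  have hCost : UnitriangularCostShapeExplicit := unitriangularCostShapeExplicit_proof
  show Literature.Computability.AlgebraicComplexity.omega ℂ = 2
  have hw2 : 2 ≤ Literature.Computability.AlgebraicComplexity.omega ℂ :=
    Literature.Computability.AlgebraicComplexity.omega_two_le ℂ
  refine le_antisymm ?_ hw2
  refine not_lt.1 fun hlt => ?_
  set w : ℝ := Literature.Computability.AlgebraicComplexity.omega ℂ with hwdef
  have hwpos : 0 < w := lt_of_lt_of_le two_pos hw2
  have hw2' : 0 < w - 2 := sub_pos.2 hlt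
  have hwne : w ≠ 0 := hwpos.ne'
  -- the loss fed to the tower
  set ε : ℝ := 3 * (w - 2) / (4 * w) with hεdef
  have hε : 0 < ε := div_pos (mul_pos three_pos hw2') (mul_pos four_pos hwpos)
  obtain ⟨d, hd3, hD⟩ := hTower ε hε
  obtain ⟨C, hC⟩ := hCost d hd3
  set b : ℝ := ((d / 2 : ℕ) : ℝ) with hbdef
  have hb : 0 < b := by
    rw [hbdef]; exact_mod_cast (show 0 < d / 2 by omega)
  set F : ℝ := ((d : ℝ) * (d - 1) / 2 - b) / 2 * w + b with hFdef
  set g : ℝ := b * (w - 2) / 4 with hgdef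
  have hg : 0 < g := div_pos (mul_pos hb hw2') four_pos
  have hεw : ε * b * (w / 3) = b * (w - 2) / 4 := by
    rw [hεdef]; field_simp
  have hexp : ((3 : ℝ) / 4 * d * (d - 1) - ε * b) * (w / 3) = g + F := by
    have : ((3 : ℝ) / 4 * d * (d - 1) - ε * b) * (w / 3) =
        (3 : ℝ) / 4 * d * (d - 1) * (w / 3) - ε * b * (w / 3) := by ring
    rw [this, hεw, hgdef, hFdef]
    ring
  -- constants
  set C' : ℝ := max C 1 with hC'def
  set K : ℝ := max 1 ((2 : ℝ) ^ F) with hKdef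
  have hC'1 : 1 ≤ C' := le_max_right _ _
  have hK1 : 1 ≤ K := le_max_left _ _
  have hC'0 : 0 ≤ C' := zero_le_one.trans hC'1
  obtain ⟨M, hM⟩ := Filter.tendsto_atTop_atTop.1 (tendsto_rpow_atTop hg) (C' * K + 1)
  obtain ⟨s, hs, X, Y, Z, hU, hT, hS, hV⟩ := hD (max 1 (Nat.ceil M))
  have hs1 : 1 ≤ s := (le_max_left _ _).trans hs
  have hsM : M ≤ (s : ℝ) :=
    (Nat.le_ceil M).trans (by exact_mod_cast (le_max_right 1 (Nat.ceil M)).trans hs)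
  have hsR1 : (1 : ℝ) ≤ s := by exact_mod_cast hs1
  have hsR0 : (0 : ℝ) < s := one_pos.trans_le hsR1
  have hcost := hC s X Y Z hU hT hS
  have hV0 : (0 : ℝ) ≤ (X.card : ℝ) * Y.card * Z.card := by positivity
  have hsF : (0 : ℝ) < (s : ℝ) ^ F := Real.rpow_pos_of_pos hsR0 F
  have h1 : (s : ℝ) ^ g * (s : ℝ) ^ F ≤ ((X.card : ℝ) * Y.card * Z.card) ^ (w / 3) := by
    rw [← Real.rpow_add hsR0, ← hexp, Real.rpow_mul hsR0.le]
    exact Real.rpow_le_rpow (Real.rpow_nonneg hsR0.le _) hV (div_nonneg hwpos.le three_pos.le)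
  have h2 : C * ((s : ℝ) + 1) ^ F ≤ C' * (K * (s : ℝ) ^ F) := by
    have hs1F : (0 : ℝ) ≤ ((s : ℝ) + 1) ^ F := Real.rpow_nonneg (by positivity) F
    have h3 : ((s : ℝ) + 1) ^ F ≤ K * (s : ℝ) ^ F := by
      rcases le_or_gt 0 F with hF | hF
      · calc ((s : ℝ) + 1) ^ F ≤ (2 * (s : ℝ)) ^ F :=
              Real.rpow_le_rpow (by positivity) (by linarith) hF
          _ = (2 : ℝ) ^ F * (s : ℝ) ^ F := Real.mul_rpow zero_le_two hsR0.le
          _ ≤ K * (s : ℝ) ^ F := mul_le_mul_of_nonneg_right (le_max_right _ _) hsF.le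
      · calc ((s : ℝ) + 1) ^ F ≤ (s : ℝ) ^ F :=
              Real.rpow_le_rpow_of_nonpos hsR0 (by linarith) hF.le
          _ = 1 * (s : ℝ) ^ F := (one_mul _).symm
          _ ≤ K * (s : ℝ) ^ F := mul_le_mul_of_nonneg_right hK1 hsF.le
    calc C * ((s : ℝ) + 1) ^ F ≤ C' * ((s : ℝ) + 1) ^ F :=
          mul_le_mul_of_nonneg_right (le_max_left _ _) hs1F
      _ ≤ C' * (K * (s : ℝ) ^ F) := mul_le_mul_of_nonneg_left h3 hC'0
  have h4 : (s : ℝ) ^ g * (s : ℝ) ^ F ≤ C' * K * (s : ℝ) ^ F := by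
    rw [mul_assoc]
    exact h1.trans (hcost.trans h2)
  have h5 : (s : ℝ) ^ g ≤ C' * K := le_of_mul_le_mul_right h4 hsF
  have h6 : C' * K + 1 ≤ (s : ℝ) ^ g := hM (s : ℝ) hsM
  linarith

/-- Section 2 again, FACTORED through the tower: `C → TowerDesigns → S`.  (The first arrow is not reversible by
anything in the tree: `TowerDesigns` lets `d → ∞` with `ε`, the crux pins `d`.) -/
theorem nilpotentThresholdDesigns_implies_matrixMultiplication' (h : NilpotentThresholdDesigns) :
    MatrixMultiplication :=
  matrixMultiplication_of_towerDesigns (towerDesigns_of_nilpotentThresholdDesigns h)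

end Summit.MatrixMultiplication.MatrixMultiplication.Cruxes.NilpotentThresholdDesigns.SummitStrength

end
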